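import Mathlib.RepresentationTheory.Homological.GroupCohomology.Shapiro
import Mathlib.RepresentationTheory.Homological.GroupCohomology.LowDegree
import Literature.Algebra.Homology.GroupCohomologyFiniteIndexFiniteness
import HarnessLib

/-!
# Functions on a `G`-set with values in a representation; free `G`-sets and Shapiro's lemma

Topic `Algebra/Homology`; namespace `Literature.Algebra.Homology`.  Definitions with body and
theorems (no named fact, no instance, no `sorry`); Mathlib + one tree file.

For a group `G`, a `k`-linear representation `ρ` of `G` on `V` and a `G`-set `Y`, the module of
ALL functions `Y → V` carries the diagonal ("twisted") representation
`(g • f)(y) = ρ(g) (f (g⁻¹ • y))` (`funRepr`, `funRep`; [Brown1982CohomologyGroups, III §5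
(5.1)–(5.4) and VII §7: for a `G`-set `Y`, `Hom_ℤ(ℤ[Y], M) = Fun(Y, M) ≅ Π_{orbits} Coind_{G_y}^G M`]).
Equivariant maps `φ : Y' → Y` act contravariantly (`funRepMap`, `f ↦ f ∘ φ`), and the constants
give `A ⟶ Fun(Y, A)` (`funRepConst`).  These are the terms of the cochain coresolution
`0 → M → Fun(X₀, M) → Fun(X₁, M) → ⋯` of a `G`-complex `X` (Brown VII §7).

Main result: if `Y` is a FREE `G`-set with finitely many orbits — presented by a section
`t : T → Y` of the orbits with `(g, i) ↦ g • t i` bijective and `T` finite — then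
`Fun(Y, A) ≅ Coind_1^G (Fun(T, A))` (`funRepIsoCoind`, the coinduced module from the trivial
subgroup in Mathlib's model `Rep.coind`), so by Shapiro's lemma (Mathlib
`groupCohomology.coindIso`) `Hⁿ(G, Fun(Y, A)) ≅ Hⁿ(1, Fun(T, A))`, which vanishes for `n ≥ 1` and
is `Fun(T, A)` for `n = 0`; hence **`Hⁿ(G, Fun(Y, A))` is finite for `A` finite**
(`finite_groupCohomology_funRep_of_free`). [cite: Brown1982CohomologyGroups, III (5.9), (6.2)]

## References

* K. S. Brown, *Cohomology of Groups*, GTM 87 (1982), III §5 (induced and coinduced modules,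
  (5.1)–(5.4), (5.9)), III (6.2) (Shapiro's lemma), VII §7 [Brown1982CohomologyGroups].
-/

noncomputable section

namespace Literature.Algebra.Homology

open CategoryTheory groupCohomology

universe u

variable {k G : Type u} [CommRing k] [Group G]

/-! ### The representation on functions `Y → V` -/

section FunRepr

variable {V : Type u} [AddCommGroup V] [Module k V] (ρ : Representation k G V)
  (Y : Type u) [MulAction G Y]

/-- **The diagonal representation on functions on a `G`-set**: `G` acts on `Fun(Y, V)` by
`(g • f)(y) = ρ(g) (f (g⁻¹ • y))` ([Brown1982CohomologyGroups, III §5]: `Hom(ℤ[Y], M)` with the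
diagonal action). [cite: Brown1982CohomologyGroups, III §5 (5.1)–(5.4)] -/
def funRepr : Representation k G (Y → V) where
  toFun g := (ρ g).compLeft Y ∘ₗ LinearMap.funLeft k V fun y : Y => g⁻¹ • y
  map_one' := by
    refine LinearMap.ext fun f => funext fun y => ?_
    simp
  map_mul' g g' := by
    refine LinearMap.ext fun f => funext fun y => ?_
    simp [mul_smul]

/-- Unfolding lemma: `(g • f)(y) = ρ(g) (f (g⁻¹ • y))`. [folklore] -/
@[simp]
theorem funRepr_apply (g : G) (f : Y → V) (y : Y) : funRepr ρ Y g f y = ρ g (f (g⁻¹ • y)) :=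
  rfl

end FunRepr

variable (A : Rep.{u} k G) (Y : Type u) [MulAction G Y]

/-- `Fun(Y, A)` as an object of Mathlib's `Rep k G`. [cite: Brown1982CohomologyGroups, III §5] -/
abbrev funRep : Rep.{u} k G :=
  Rep.of (funRepr A.ρ Y)

/-- **Contravariant functoriality in the `G`-set**: an equivariant map `φ : Y' → Y` induces
`Fun(Y, A) ⟶ Fun(Y', A)`, `f ↦ f ∘ φ`. [folklore] -/
def funRepMap {Y' : Type u} [MulAction G Y'] (φ : Y' → Y) (hφ : ∀ (g : G) (y : Y'), φ (g • y) = g • φ y) :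
    funRep A Y ⟶ funRep A Y' :=
  Rep.ofHom
    { toLinearMap := LinearMap.funLeft k A φ
      isIntertwining' := fun g => by
        refine LinearMap.ext fun f => funext fun y => ?_
        change A.ρ g (f (g⁻¹ • φ y)) = A.ρ g (f (φ (g⁻¹ • y)))
        rw [hφ] }

/-- `funRepMap` is precomposition. [folklore] -/
@[simp]
theorem funRepMap_hom_apply {Y' : Type u} [MulAction G Y'] (φ : Y' → Y)
    (hφ : ∀ (g : G) (y : Y'), φ (g • y) = g • φ y) (f : funRep A Y) (y : Y') :
    ((funRepMap A Y φ hφ).hom f : Y' → A) y = (f : Y → A) (φ y) :=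
  rfl

/-- **The constants** `A ⟶ Fun(Y, A)`, `a ↦ (y ↦ a)` (the coaugmentation of the cochain
coresolution of a `G`-complex). [cite: Brown1982CohomologyGroups, VII §7] -/
def funRepConst : A ⟶ funRep A Y :=
  Rep.ofHom
    { toLinearMap :=
        { toFun := fun a _ => a
          map_add' := fun _ _ => rfl
          map_smul' := fun _ _ => rfl }
      isIntertwining' := fun g => by
        refine LinearMap.ext fun a => funext fun y => ?_
        rfl }

/-- `funRepConst a` is the constant function. [folklore] -/
@[simp]
theorem funRepConst_hom_apply (a : A) (y : Y) : ((funRepConst A Y).hom a : Y → A) y = a :=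
  rfl

/-! ### Free `G`-sets with finitely many orbits: `Fun(Y, A) ≅ Coind_1^G Fun(T, A)` -/

section Free

variable {T : Type u} (t : T → Y) (hbij : Function.Bijective fun p : G × T => p.1 • t p.2)

/-- The coefficients `Fun(T, A)` over a set `T` of orbit representatives, as a representation of
the trivial subgroup. [folklore] -/
abbrev orbitCoeff (T : Type u) : Rep.{u} k (⊥ : Subgroup G) :=
  Rep.trivial k (⊥ : Subgroup G) (T → A)

/-- The comparison map `Fun(Y, A) → Coind_1^G Fun(T, A)`, `f ↦ (x ↦ (i ↦ ρ(x) f(x⁻¹ • t i)))`,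
as a linear map into functions `G → Fun(T, A)`. [folklore] -/
def toCoindFun : (Y → A) →ₗ[k] (G → T → A) where
  toFun f x i := A.ρ x (f (x⁻¹ • t i))
  map_add' f f' := by
    funext x i
    simp
  map_smul' r f := by
    funext x i
    simp

/-- Unfolding lemma for `toCoindFun`. [folklore] -/
@[simp]
theorem toCoindFun_apply (f : Y → A) (x : G) (i : T) :
    toCoindFun A Y t f x i = A.ρ x (f (x⁻¹ • t i)) :=
  rfl

/-- Every function `G → Fun(T, A)` lies in Mathlib's coinduced module from the trivial subgroup
(the equivariance condition is vacuous). [folklore] -/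
theorem mem_coindV_bot (F : G → T → A) :
    F ∈ Representation.coindV (⊥ : Subgroup G).subtype (orbitCoeff (k := k) A T).ρ := by
  rw [Representation.mem_coindV]
  intro g x
  have hg : (g : G) = 1 := Subgroup.mem_bot.1 g.2
  simp [hg]

include hbij in
/-- Uniqueness of the decomposition `y = g • t i` of a free `G`-set with section `t`. [folklore] -/
theorem smul_eq_smul_iff {g g' : G} {i i' : T} : g • t i = g' • t i' ↔ g = g' ∧ i = i' := by
  constructor
  · intro h
    have h' := hbij.1 (a₁ := (g, i)) (a₂ := (g', i')) h
    exact ⟨congrArg Prod.fst h', congrArg Prod.snd h'⟩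
  · rintro ⟨rfl, rfl⟩
    rfl

/-- The decomposition of a free `G`-set with finitely many orbits along a section `t`:
`G × T ≃ Y`, `(g, i) ↦ g • t i`. [folklore] -/
def orbitDecomposition : G × T ≃ Y :=
  Equiv.ofBijective _ hbij

/-- `orbitDecomposition (g, i) = g • t i`. [folklore] -/
@[simp]
theorem orbitDecomposition_apply (p : G × T) : orbitDecomposition Y t hbij p = p.1 • t p.2 :=
  rfl

/-- `orbitDecomposition⁻¹ (g • t i) = (g, i)`. [folklore] -/
theorem orbitDecomposition_symm_smul (g : G) (i : T) :
    (orbitDecomposition Y t hbij).symm (g • t i) = (g, i) :=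
  (orbitDecomposition Y t hbij).symm_apply_eq.2 rfl

/-- The inverse comparison `Coind_1^G Fun(T, A) → Fun(Y, A)`: `F ↦ (g • t i ↦ ρ(g) (F g⁻¹ i))`.
[folklore] -/
def ofCoindFun : (G → T → A) →ₗ[k] (Y → A) where
  toFun F y := A.ρ ((orbitDecomposition Y t hbij).symm y).1
    (F ((orbitDecomposition Y t hbij).symm y).1⁻¹ ((orbitDecomposition Y t hbij).symm y).2)
  map_add' F F' := by
    funext y
    simp
  map_smul' r F := by
    funext y
    simp

/-- `ofCoindFun F (g • t i) = ρ(g) (F g⁻¹ i)`. [folklore] -/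
theorem ofCoindFun_smul (F : G → T → A) (g : G) (i : T) :
    ofCoindFun A Y t hbij F (g • t i) = A.ρ g (F g⁻¹ i) := by
  change A.ρ ((orbitDecomposition Y t hbij).symm (g • t i)).1 _ = _
  rw [orbitDecomposition_symm_smul]

/-- `ofCoindFun ∘ toCoindFun = id`. [folklore] -/
theorem ofCoindFun_toCoindFun (f : Y → A) : ofCoindFun A Y t hbij (toCoindFun A Y t f) = f := by
  funext y
  obtain ⟨⟨g, i⟩, rfl⟩ := hbij.2 y
  change ofCoindFun A Y t hbij (toCoindFun A Y t f) (g • t i) = f (g • t i)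
  rw [ofCoindFun_smul, toCoindFun_apply, inv_inv, ← Module.End.mul_apply, ← map_mul,
    mul_inv_cancel, map_one, Module.End.one_apply]

/-- `toCoindFun ∘ ofCoindFun = id`. [folklore] -/
theorem toCoindFun_ofCoindFun (F : G → T → A) : toCoindFun A Y t (ofCoindFun A Y t hbij F) = F := by
  funext x i
  rw [toCoindFun_apply, ofCoindFun_smul, inv_inv, ← Module.End.mul_apply, ← map_mul,
    mul_inv_cancel, map_one, Module.End.one_apply]

/-- The comparison as a linear equivalence `Fun(Y, A) ≃ₗ Coind_1^G Fun(T, A)` (onto Mathlib's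
`Representation.coindV`). [folklore] -/
def funRepCoindLinearEquiv :
    (Y → A) ≃ₗ[k] Representation.coindV (⊥ : Subgroup G).subtype (orbitCoeff (k := k) A T).ρ where
  toFun f := ⟨toCoindFun A Y t f, mem_coindV_bot A (toCoindFun A Y t f)⟩
  map_add' f f' := Subtype.ext (map_add _ f f')
  map_smul' r f := Subtype.ext (map_smul _ r f)
  invFun F := ofCoindFun A Y t hbij F.1
  left_inv f := ofCoindFun_toCoindFun A Y t hbij f
  right_inv F := Subtype.ext (toCoindFun_ofCoindFun A Y t hbij F.1)

/-- Unfolding lemma for `funRepCoindLinearEquiv`. [folklore] -/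
@[simp]
theorem funRepCoindLinearEquiv_apply_coe (f : Y → A) :
    ((funRepCoindLinearEquiv A Y t hbij f : Representation.coindV (⊥ : Subgroup G).subtype
      (orbitCoeff (k := k) A T).ρ) : G → T → A) = toCoindFun A Y t f :=
  rfl

/-- **`Fun(Y, A) ≅ Coind_1^G Fun(T, A)` for a free `G`-set `Y` with section `t : T → Y`**
(`f ↦ (x ↦ (i ↦ ρ(x) f(x⁻¹ • t i)))`; equivariance: `ρ(x) ((g • f)(x⁻¹ • t i)) =
ρ(x g) (f ((x g)⁻¹ • t i))`).  This is [Brown1982CohomologyGroups, III (5.9) with (5.4)]: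
`Hom(ℤ[Y], M) ≅ Coind_1^G Hom(ℤ[T], M)` for `ℤ[Y] ≅ Ind_1^G ℤ[T]` free.
[cite: Brown1982CohomologyGroups, III (5.4), (5.9)] -/
def funRepIsoCoind :
    funRep A Y ≅ Rep.coind (⊥ : Subgroup G).subtype (orbitCoeff (k := k) A T) :=
  Rep.mkIso (Representation.Equiv.mk (funRepCoindLinearEquiv A Y t hbij) fun g => by
    refine LinearMap.ext fun f => Subtype.ext (funext fun x => funext fun i => ?_)
    change A.ρ x ((funRepr A.ρ Y g f) (x⁻¹ • t i)) = A.ρ (x * g) (f ((x * g)⁻¹ • t i))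
    rw [funRepr_apply, ← mul_smul, ← mul_inv_rev, map_mul, Module.End.mul_apply])

/-- **`Hⁿ(G, Fun(Y, A))` is finite for a free `G`-set `Y` with finitely many orbits and `A`
finite**: `Hⁿ(G, Fun(Y, A)) ≅ Hⁿ(G, Coind_1^G Fun(T, A)) ≅ Hⁿ(1, Fun(T, A))` (Shapiro's lemma,
Mathlib `groupCohomology.coindIso`), which is `0` for `n ≥ 1`
(`isZero_groupCohomology_succ_of_subsingleton`) and `Fun(T, A)ᴳ ⊆ Fun(T, A)` for `n = 0`.
[cite: Brown1982CohomologyGroups, III (6.2) Shapiro's lemma] -/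
theorem finite_groupCohomology_funRep_of_free (hbij : Function.Bijective fun p : G × T => p.1 • t p.2) [Finite T] [Finite A] (n : ℕ) :
    Finite (groupCohomology (funRep A Y) n) := by
  have e := ((groupCohomology.functor k G n).mapIso (funRepIsoCoind A Y t hbij)).toLinearEquiv.toEquiv
  haveI : Finite (groupCohomology (orbitCoeff (k := k) A T) n) := by
    cases n with
    | zero =>
      haveI : Finite (orbitCoeff (k := k) A T) := inferInstanceAs (Finite (T → A))
      exact finite_groupCohomology_zero _
    | succ m =>
      haveI := ModuleCat.subsingleton_of_isZero
        (isZero_groupCohomology_succ_of_subsingleton (orbitCoeff (k := k) A T) m)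
      infer_instance
  haveI hc : Finite (groupCohomology (Rep.coind (⊥ : Subgroup G).subtype (orbitCoeff (k := k) A T)) n) :=
    Finite.of_equiv _ (groupCohomology.coindIso (orbitCoeff (k := k) A T) n).toLinearEquiv.toEquiv.symm
  exact Finite.of_equiv (groupCohomology (Rep.coind (⊥ : Subgroup G).subtype
    (orbitCoeff (k := k) A T)) n) e.symm

end Free

end Literature.Algebra.Homology
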